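import Literature.NumberTheory.EllipticCurves.HeightsProofs
import Literature.NumberTheory.EllipticCurves.HeegnerPointsLeavesProofs
import HarnessLib

/-!
# Gross–Zagier 1986, V.(1.1): `L'(E/K, 1) ≥ 0` — "what would be predicted by the Riemann hypothesis"

Topic `Literature/NumberTheory/EllipticCurves`. **Gross–Zagier, *Heegner points and derivatives
of `L`-series*, Invent. Math. 84 (1986), V.(1.1) Corollary** (p. 308–309), as printed: "Let
`f ∈ S₂(Γ₀(N))` be any newform and `χ` any character of `Gal(H/K)`. Then `L'(f, χ, 1) ≥ 0`. This
follows immediately from the formula for `L'(f, χ, 1)` since both the Petersson product and the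
global height pairing are positive definite. Notice that Corollary (1.1) is what would be predicted
by the Riemann hypothesis for `L(f, χ, s)`, according to which the largest zero of the real
function `L(f, χ, s)` on the real axis should occur at `s = 1`."

Here: the case of the rational newform of an elliptic curve `E/ℚ` and the trivial character
`χ = 1`, where `L(f, 1, s) = L(E/K, s) = L(E, s) L(E^{(d_K)}, s)` and `L'(f, 1, 1)` is the tree's
`LDerivEK W K` (`HeegnerPoints.lean`). PROVED (`lDerivEK_nonneg`) from the tree's named facts
`gross_zagier N W K` (the formula `L'(E/K, 1) = (2 covol(Λ_E)/(c² u² √|d_K|)) · ĥ(P_K)`, Thm. I.6.3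
with V.§2) and `exists_isHeegnerPoint W K` (the Heegner point `P_K ∈ E(K)`, I.§4), and the PROVED
non-negativity of the Néron–Tate height (`canonicalHeight_nonneg_holds`, Silverman AEC
VIII.9.3(d)); the constant is non-negative by inspection (`covol > 0`, squares, a square root). The
value `L'(E/K, 1)` is thereby REAL and `≥ 0`. A corollary threads the Heegner-point existence
through its printed leaves (`exists_isHeegnerPoint_of_leaves`: modularity `exists_isNewformOf`,
Eichler–Shimura, Faltings, lattice commensurability, Galois descent of Heegner points).

Not here: general `(f, χ)` (no carrier for `L(f, χ, s)` with `χ ≠ 1` or non-rational `f`).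

## References

* [GrossZagierInvent1986] B. H. Gross, D. B. Zagier, Invent. Math. 84 (1986), V.(1.1) Corollary
  and the remark following it (pp. 308–309); I.(6.3).
* [SilvermanAEC2009] J. H. Silverman, *The Arithmetic of Elliptic Curves*, 2nd ed., Thm. VIII.9.3(d).
-/

noncomputable section

open scoped Classical

open WeierstrassCurve MeasureTheory Literature.NumberTheory.EllipticCurves.ModularForms

universe u

namespace Literature.NumberTheory.EllipticCurves

variable (W : WeierstrassCurve ℚ) (K : Type u) [Field K] [NumberField K]

/-- **Gross–Zagier 1986, V.(1.1), case `E/ℚ`, `χ = 1`: `L'(E/K, 1) ≥ 0`** ("what would be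
predicted by the Riemann hypothesis for `L(f, χ, s)`"). For a globally minimal elliptic `W/ℚ` of
conductor `N_E` and an imaginary quadratic `K` in which every prime dividing `N_E` splits:
granted the Gross–Zagier formula at level `N_E` (`gross_zagier`, hypothesis `hGZ`) and the
existence of the Heegner point `P_K ∈ E(K)` (`exists_isHeegnerPoint`, hypothesis `hHP`),
`L'(E/K, 1) = (2 covol(Λ_E)/(c² u² √|d_K|)) · ĥ(P_K)` is a non-negative real number: the constant
is `≥ 0` and `ĥ(P_K) ≥ 0` (`canonicalHeight_nonneg_holds`, Silverman AEC VIII.9.3(d) — "the global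
height pairing [is] positive definite"). Stated as `0 ≤ re` and `im = 0` of the complex number
`LDerivEK W K`. [cite: GrossZagierInvent1986, V.(1.1) Corollary (pp. 308–309)] -/
theorem lDerivEK_nonneg [W.IsElliptic] [W.IsGloballyMinimal] [NeZero (W.conductorNorm ℤ)]
    (hGZ : gross_zagier (W.conductorNorm ℤ) W K) (hHP : exists_isHeegnerPoint W K)
    (hK : IsImaginaryQuadratic K) (hH : SatisfiesHeegnerHypothesis (W.conductorNorm ℤ) K) :
    0 ≤ (LDerivEK W K).re ∧ (LDerivEK W K).im = 0 := by
  obtain ⟨P, Dt, H, ι, hP⟩ := hHP hK hH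
  have hformula := hGZ hK hH Dt H ι P hP
  rw [hformula, Complex.ofReal_re, Complex.ofReal_im]
  refine ⟨mul_nonneg ?_ ?_, rfl⟩
  · -- the Gross–Zagier constant `2 covol(Λ_E) / (c² u² √|d_K|)` is non-negative
    refine div_nonneg (mul_nonneg (by norm_num) (ZLattice.covolume_pos Dt.L.lattice _).le) ?_
    exact mul_nonneg (mul_nonneg (sq_nonneg _) (sq_nonneg _)) (Real.sqrt_nonneg _)
  · -- `ĥ(P_K) ≥ 0`
    exact WeierstrassCurve.Affine.Point.canonicalHeight_nonneg_holds (W := W.baseChange K) P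

/-- **Gross–Zagier 1986, V.(1.1) (`E/ℚ`, `χ = 1`) from the Gross–Zagier formula and the printed
leaves of the Heegner-point construction**: as `lDerivEK_nonneg`, with `exists_isHeegnerPoint W K`
replaced by its inputs (`exists_isHeegnerPoint_of_leaves`): modularity "Version `a_p`"
(`exists_isNewformOf`), the Eichler–Shimura construction, Faltings' isogeny theorem, the
commensurability of period lattices of isogenous curves, and the Galois descent of Heegner points
over the Hilbert class field (`heegnerPoints_galoisConj`). [cite: GrossZagierInvent1986, V.(1.1) Corollary (pp. 308–309)] -/
theorem lDerivEK_nonneg_of_leaves [W.IsElliptic] [W.IsGloballyMinimal] [NeZero (W.conductorNorm ℤ)]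
    (hGZ : gross_zagier (W.conductorNorm ℤ) W K) (h₁ : exists_isNewformOf)
    (hES : eichlerShimuraConstruction) (hF : WeierstrassCurve.isIsogenous_iff_frobeniusTrace_eq)
    (hI : neronLattice_commensurable_of_isIsogenous)
    (hCM : ∀ [NeZero (W.conductorNorm ℤ)], heegnerPoints_galoisConj (W.conductorNorm ℤ) W K)
    (hK : IsImaginaryQuadratic K) (hH : SatisfiesHeegnerHypothesis (W.conductorNorm ℤ) K) :
    0 ≤ (LDerivEK W K).re ∧ (LDerivEK W K).im = 0 :=
  lDerivEK_nonneg W K hGZ (exists_isHeegnerPoint_of_leaves W K h₁ hES hF hI hCM) hK hH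

end Literature.NumberTheory.EllipticCurves
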